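import Mathlib
import HarnessLib
import Summits.NavierStokesRegularity.NavierStokesRegularity.Theorems.PoloidalWindowDoorLrcModEntireAxisKinematics

/-!
# Route `PoloidalWindowDoor`, item `LrcModEntire` (stmt-NavierStokesRegularity-20428) — AXIS KINEMATICS II: the horizontal Laplacian of a
# function with a rotation germ has the same rotation germ (`[Δ_h, L_c] = 0`)

Cell ns-regularity-ideate, seat ns-poloidal-K2-p3 gen 5 (LEAD of item 20428; file landed `--supports stmt-NavierStokesRegularity-20428` as a
helper).  Second kernel brick of AXIS-NOTE (step 2–3: «`∂_z v_h = ∇_h Q` with `Q` rotation-invariant ⇒ `div_h ∂_z v_h = Δ_h Q` rotation-invariant»):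
for `f ∈ C³(ℝ³)` and the generator `L_c f(y) := Df(y)[J(y − c)] = (y₀ − c₀)∂₁f − (y₁ − c₁)∂₀f` of the rotations about the vertical axis through `c`,
the horizontal Laplacian `Δ_h f = ∂₀²f + ∂₁²f` satisfies `L_c(Δ_h f) = Δ_h(L_c f)` pointwise (the two cross terms `2∂₀∂₁f − 2∂₁∂₀f` cancel by the
symmetry of second derivatives, and `Δ_h ∂_i f = ∂_i Δ_h f` by that of third derivatives); hence `L_c f = 0` on an open set forces `L_c(Δ_h f) = 0`
there.

* `fderiv_coordMul`, `fderiv2_coordMul` — product rule for `y ↦ (y_i − c_i) h(y)`, first and (diagonal) second horizontal derivatives;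
* `laplacianH_rotDeriv` — **`Δ_h (L_c f) = L_c (Δ_h f)`** for `f ∈ C³`;
* `rotGerm_laplacianH` — **`L_c f = 0` on an open `U` ⇒ `L_c(Δ_h f) = 0` on `U`.**

(`Δ_h` is written out as `∂₀(∂₀ f) + ∂₁(∂₁ f)` with `∂_a g := y ↦ Dg(y) e_a`, the convention of `…ConstantShearSlice.wave_identity` /
`…TimeHeightShearLinearSlice`.)  WHAT THIS IS NOT: not a claim about Navier–Stokes regularity and not the axis lemma — calculus
(bears_on LADDER-NS N0 via item 20428).
-/

noncomputable section

-- the summit and its single sub-problem share the name (CONVENTIONS §1), as in every Theorems file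
set_option linter.dupNamespace false

namespace Summit.NavierStokesRegularity.NavierStokesRegularity.Theorems.PoloidalWindowDoorLrcModEntireAxisKinematics2

open Set Function Filter Topology Metric
open scoped RealInnerProductSpace InnerProductSpace
open Literature.Analysis Literature.Analysis.FluidPDE
open Summit.NavierStokesRegularity.NavierStokesRegularity.Theorems.PoloidalWindowDoorPoloidalWindowRigidityConstantShearMeans
open Summit.NavierStokesRegularity.NavierStokesRegularity.Theorems.PoloidalWindowDoorLrcModEntireAxisKinematics

/-! ### Product rule for `y ↦ (y_i − c_i) · h(y)` -/

/-- The coordinate function `y ↦ y_i − c_i` has derivative `w ↦ w_i`. -/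
theorem hasFDerivAt_coordSub (c y : EuclideanSpace ℝ (Fin 3)) (i : Fin 3) :
    HasFDerivAt (fun y : EuclideanSpace ℝ (Fin 3) => y i - c i)
      (EuclideanSpace.proj i : EuclideanSpace ℝ (Fin 3) →L[ℝ] ℝ) y :=
  (EuclideanSpace.proj i : EuclideanSpace ℝ (Fin 3) →L[ℝ] ℝ).hasFDerivAt.sub_const _

/-- **First derivative of `(y_i − c_i) h`** along `e_j`: `δ_{ij} h(y) + (y_i − c_i) Dh(y) e_j`. -/
theorem fderiv_coordMul {h : EuclideanSpace ℝ (Fin 3) → ℝ} {y : EuclideanSpace ℝ (Fin 3)} (hh : DifferentiableAt ℝ h y)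
    (c : EuclideanSpace ℝ (Fin 3)) (i j : Fin 3) :
    fderiv ℝ (fun y' : EuclideanSpace ℝ (Fin 3) => (y' i - c i) * h y') y (EuclideanSpace.single j 1) =
      (if j = i then 1 else 0) * h y + (y i - c i) * fderiv ℝ h y (EuclideanSpace.single j 1) := by
  rw [fderiv_fun_mul (hasFDerivAt_coordSub c y i).differentiableAt hh, add_apply, smul_apply, smul_apply,
    (hasFDerivAt_coordSub c y i).fderiv, smul_eq_mul, smul_eq_mul]
  have hp : (EuclideanSpace.proj i : EuclideanSpace ℝ (Fin 3) →L[ℝ] ℝ) (EuclideanSpace.single j (1 : ℝ)) =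
      if j = i then 1 else 0 := by
    show (EuclideanSpace.single j (1 : ℝ) : EuclideanSpace ℝ (Fin 3)) i = _
    simp [eq_comm]
  rw [hp]
  ring

/-- **Diagonal second derivative of `(y_i − c_i) h`** along `e_j` twice: `2 δ_{ij} ∂_j h(y) + (y_i − c_i) ∂_j² h(y)` (`h ∈ C²`). -/
theorem fderiv2_coordMul {h : EuclideanSpace ℝ (Fin 3) → ℝ} (hh : ContDiff ℝ 2 h) (c y : EuclideanSpace ℝ (Fin 3)) (i j : Fin 3) :
    fderiv ℝ (fun y' => fderiv ℝ (fun y'' : EuclideanSpace ℝ (Fin 3) => (y'' i - c i) * h y'') y' (EuclideanSpace.single j 1)) y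
        (EuclideanSpace.single j 1) =
      2 * (if j = i then 1 else 0) * fderiv ℝ h y (EuclideanSpace.single j 1) +
        (y i - c i) * fderiv ℝ (fun y' => fderiv ℝ h y' (EuclideanSpace.single j 1)) y (EuclideanSpace.single j 1) := by
  have hd : Differentiable ℝ h := hh.differentiable (by norm_num)
  -- the first derivative as a function
  have hfun : (fun y' => fderiv ℝ (fun y'' : EuclideanSpace ℝ (Fin 3) => (y'' i - c i) * h y'') y' (EuclideanSpace.single j 1)) =
      fun y' => (if j = i then 1 else 0) * h y' + (y' i - c i) * fderiv ℝ h y' (EuclideanSpace.single j 1) := by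
    funext y'
    exact fderiv_coordMul (hd y') c i j
  have hdj : Differentiable ℝ (fun y' => fderiv ℝ h y' (EuclideanSpace.single j 1)) :=
    ((hh.fderiv_right (m := 1) (by norm_num)).clm_apply contDiff_const).differentiable one_ne_zero
  have hD : HasFDerivAt (fun y' : EuclideanSpace ℝ (Fin 3) =>
        (if j = i then 1 else 0) * h y' + (y' i - c i) * fderiv ℝ h y' (EuclideanSpace.single j 1))
      ((if j = i then (1 : ℝ) else 0) • fderiv ℝ h y +
        ((y i - c i) • fderiv ℝ (fun y' => fderiv ℝ h y' (EuclideanSpace.single j 1)) y +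
          fderiv ℝ h y (EuclideanSpace.single j 1) • (EuclideanSpace.proj i : EuclideanSpace ℝ (Fin 3) →L[ℝ] ℝ))) y :=
    ((hd y).hasFDerivAt.const_mul _).add ((hasFDerivAt_coordSub c y i).mul (hdj y).hasFDerivAt)
  rw [hfun, hD.fderiv]
  have hp : (EuclideanSpace.proj i : EuclideanSpace ℝ (Fin 3) →L[ℝ] ℝ) (EuclideanSpace.single j (1 : ℝ)) =
      if j = i then 1 else 0 := by
    show (EuclideanSpace.single j (1 : ℝ) : EuclideanSpace ℝ (Fin 3)) i = _
    simp [eq_comm]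
  simp only [add_apply, smul_apply, smul_eq_mul, hp]
  ring

/-- `fderiv2_coordMul` on the diagonal `j = i`: `2 ∂_i h + (y_i − c_i) ∂_i² h`. -/
theorem fderiv2_coordMul_same {h : EuclideanSpace ℝ (Fin 3) → ℝ} (hh : ContDiff ℝ 2 h) (c y : EuclideanSpace ℝ (Fin 3)) (i : Fin 3) :
    fderiv ℝ (fun y' => fderiv ℝ (fun y'' : EuclideanSpace ℝ (Fin 3) => (y'' i - c i) * h y'') y' (EuclideanSpace.single i 1)) y
        (EuclideanSpace.single i 1) =
      2 * fderiv ℝ h y (EuclideanSpace.single i 1) +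
        (y i - c i) * fderiv ℝ (fun y' => fderiv ℝ h y' (EuclideanSpace.single i 1)) y (EuclideanSpace.single i 1) := by
  rw [fderiv2_coordMul hh c y i i, if_pos rfl, mul_one]

/-- `fderiv2_coordMul` off the diagonal `j ≠ i`: `(y_i − c_i) ∂_j² h`. -/
theorem fderiv2_coordMul_ne {h : EuclideanSpace ℝ (Fin 3) → ℝ} (hh : ContDiff ℝ 2 h) (c y : EuclideanSpace ℝ (Fin 3)) {i j : Fin 3}
    (hji : j ≠ i) :
    fderiv ℝ (fun y' => fderiv ℝ (fun y'' : EuclideanSpace ℝ (Fin 3) => (y'' i - c i) * h y'') y' (EuclideanSpace.single j 1)) y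
        (EuclideanSpace.single j 1) =
      (y i - c i) * fderiv ℝ (fun y' => fderiv ℝ h y' (EuclideanSpace.single j 1)) y (EuclideanSpace.single j 1) := by
  rw [fderiv2_coordMul hh c y i j, if_neg hji, mul_zero, zero_mul, zero_add]

/-! ### `[Δ_h, L_c] = 0` -/

/-- **The horizontal Laplacian commutes with the rotation generator**: for `f ∈ C³(ℝ³)`,
`Δ_h(L_c f)(y) = L_c(Δ_h f)(y)`, where `L_c f(y) = (y₀ − c₀)∂₁f(y) − (y₁ − c₁)∂₀f(y) = Df(y)[J(y − c)]` and `Δ_h = ∂₀² + ∂₁²`. -/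
theorem laplacianH_rotDeriv {f : EuclideanSpace ℝ (Fin 3) → ℝ} (hf : ContDiff ℝ 3 f) (c y : EuclideanSpace ℝ (Fin 3)) :
    fderiv ℝ (fun y' => fderiv ℝ (fun y'' => fderiv ℝ f y'' (rotGen (y'' - c))) y' (EuclideanSpace.single 0 1)) y
          (EuclideanSpace.single 0 1) +
        fderiv ℝ (fun y' => fderiv ℝ (fun y'' => fderiv ℝ f y'' (rotGen (y'' - c))) y' (EuclideanSpace.single 1 1)) y
          (EuclideanSpace.single 1 1) =
      (y 0 - c 0) *
          fderiv ℝ (fun y' => fderiv ℝ (fun y'' => fderiv ℝ f y'' (EuclideanSpace.single 0 1)) y' (EuclideanSpace.single 0 1) +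
            fderiv ℝ (fun y'' => fderiv ℝ f y'' (EuclideanSpace.single 1 1)) y' (EuclideanSpace.single 1 1)) y
            (EuclideanSpace.single 1 1) -
        (y 1 - c 1) *
          fderiv ℝ (fun y' => fderiv ℝ (fun y'' => fderiv ℝ f y'' (EuclideanSpace.single 0 1)) y' (EuclideanSpace.single 0 1) +
            fderiv ℝ (fun y'' => fderiv ℝ f y'' (EuclideanSpace.single 1 1)) y' (EuclideanSpace.single 1 1)) y
            (EuclideanSpace.single 0 1) := by
  -- notation-free abbreviations for the partials of `f`
  have h1 : ∀ a : EuclideanSpace ℝ (Fin 3), ContDiff ℝ 2 (fun y' => fderiv ℝ f y' a) := fun a =>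
    (hf.fderiv_right (m := 2) (by norm_num)).clm_apply contDiff_const
  have h2 : ∀ a b : EuclideanSpace ℝ (Fin 3), ContDiff ℝ 1 (fun y' => fderiv ℝ (fun y'' => fderiv ℝ f y'' a) y' b) :=
    fun a b => ((h1 a).fderiv_right (m := 1) (by norm_num)).clm_apply contDiff_const
  have hd2 : ∀ a b : EuclideanSpace ℝ (Fin 3), Differentiable ℝ (fun y' => fderiv ℝ (fun y'' => fderiv ℝ f y'' a) y' b) :=
    fun a b => (h2 a b).differentiable one_ne_zero
  -- `L_c f` written with the coordinate products
  have hL : (fun y'' => fderiv ℝ f y'' (rotGen (y'' - c))) = fun y'' =>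
      (y'' 0 - c 0) * fderiv ℝ f y'' (EuclideanSpace.single 1 1) - (y'' 1 - c 1) * fderiv ℝ f y'' (EuclideanSpace.single 0 1) := by
    funext y''; exact fderiv_rotGen_sub_eq f y'' c
  -- second derivatives of the two products
  have hA0 := fderiv2_coordMul_same (h1 (EuclideanSpace.single 1 1)) c y 0
  have hA1 := fderiv2_coordMul_ne (h1 (EuclideanSpace.single 1 1)) c y (i := 0) (j := 1) (by decide)
  have hB0 := fderiv2_coordMul_ne (h1 (EuclideanSpace.single 0 1)) c y (i := 1) (j := 0) (by decide)
  have hB1 := fderiv2_coordMul_same (h1 (EuclideanSpace.single 0 1)) c y 1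
  -- differentiability of the first derivatives of the products (to split `∂_j²` over the difference)
  have hdprod : ∀ (i : Fin 3) (a : EuclideanSpace ℝ (Fin 3)) (j : Fin 3), Differentiable ℝ (fun y' => fderiv ℝ
      (fun y'' : EuclideanSpace ℝ (Fin 3) => (y'' i - c i) * fderiv ℝ f y'' a) y' (EuclideanSpace.single j 1)) := by
    intro i a j
    have hfun : (fun y' => fderiv ℝ (fun y'' : EuclideanSpace ℝ (Fin 3) => (y'' i - c i) * fderiv ℝ f y'' a) y'
        (EuclideanSpace.single j 1)) = fun y' => (if j = i then 1 else 0) * fderiv ℝ f y' a +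
          (y' i - c i) * fderiv ℝ (fun y'' => fderiv ℝ f y'' a) y' (EuclideanSpace.single j 1) := by
      funext y'
      exact fderiv_coordMul (((h1 _).differentiable (by norm_num)) y') c i j
    rw [hfun]
    intro y'
    exact ((((h1 _).differentiable (by norm_num)) y').const_mul _).add
      ((hasFDerivAt_coordSub c y' i).differentiableAt.mul (hd2 _ _ y'))
  -- `∂_j (L f) = ∂_j A − ∂_j B` as functions, then `∂_j² (L f) = ∂_j² A − ∂_j² B`
  have hsplit : ∀ j : Fin 3,
      fderiv ℝ (fun y' => fderiv ℝ (fun y'' => fderiv ℝ f y'' (rotGen (y'' - c))) y' (EuclideanSpace.single j 1)) y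
          (EuclideanSpace.single j 1) =
        fderiv ℝ (fun y' => fderiv ℝ (fun y'' : EuclideanSpace ℝ (Fin 3) =>
            (y'' 0 - c 0) * fderiv ℝ f y'' (EuclideanSpace.single 1 1)) y' (EuclideanSpace.single j 1)) y (EuclideanSpace.single j 1) -
        fderiv ℝ (fun y' => fderiv ℝ (fun y'' : EuclideanSpace ℝ (Fin 3) =>
            (y'' 1 - c 1) * fderiv ℝ f y'' (EuclideanSpace.single 0 1)) y' (EuclideanSpace.single j 1)) y (EuclideanSpace.single j 1) := by
    intro j
    have hfun : (fun y' => fderiv ℝ (fun y'' => fderiv ℝ f y'' (rotGen (y'' - c))) y' (EuclideanSpace.single j 1)) =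
        fun y' => fderiv ℝ (fun y'' : EuclideanSpace ℝ (Fin 3) => (y'' 0 - c 0) * fderiv ℝ f y'' (EuclideanSpace.single 1 1)) y'
            (EuclideanSpace.single j 1) -
          fderiv ℝ (fun y'' : EuclideanSpace ℝ (Fin 3) => (y'' 1 - c 1) * fderiv ℝ f y'' (EuclideanSpace.single 0 1)) y'
            (EuclideanSpace.single j 1) := by
      funext y'
      have hDA : HasFDerivAt (fun y'' : EuclideanSpace ℝ (Fin 3) => (y'' 0 - c 0) * fderiv ℝ f y'' (EuclideanSpace.single 1 1))
          ((y' 0 - c 0) • fderiv ℝ (fun y'' => fderiv ℝ f y'' (EuclideanSpace.single 1 1)) y' +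
            fderiv ℝ f y' (EuclideanSpace.single 1 1) • (EuclideanSpace.proj (0 : Fin 3) : EuclideanSpace ℝ (Fin 3) →L[ℝ] ℝ)) y' :=
        (hasFDerivAt_coordSub c y' 0).mul (((h1 _).differentiable (by norm_num)) y').hasFDerivAt
      have hDB : HasFDerivAt (fun y'' : EuclideanSpace ℝ (Fin 3) => (y'' 1 - c 1) * fderiv ℝ f y'' (EuclideanSpace.single 0 1))
          ((y' 1 - c 1) • fderiv ℝ (fun y'' => fderiv ℝ f y'' (EuclideanSpace.single 0 1)) y' +
            fderiv ℝ f y' (EuclideanSpace.single 0 1) • (EuclideanSpace.proj (1 : Fin 3) : EuclideanSpace ℝ (Fin 3) →L[ℝ] ℝ)) y' :=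
        (hasFDerivAt_coordSub c y' 1).mul (((h1 _).differentiable (by norm_num)) y').hasFDerivAt
      rw [hL, fderiv_fun_sub hDA.differentiableAt hDB.differentiableAt, sub_apply]
    have hD2 : HasFDerivAt (fun y' => fderiv ℝ (fun y'' : EuclideanSpace ℝ (Fin 3) =>
            (y'' 0 - c 0) * fderiv ℝ f y'' (EuclideanSpace.single 1 1)) y' (EuclideanSpace.single j 1) -
          fderiv ℝ (fun y'' : EuclideanSpace ℝ (Fin 3) => (y'' 1 - c 1) * fderiv ℝ f y'' (EuclideanSpace.single 0 1)) y'
            (EuclideanSpace.single j 1))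
        (fderiv ℝ (fun y' => fderiv ℝ (fun y'' : EuclideanSpace ℝ (Fin 3) =>
            (y'' 0 - c 0) * fderiv ℝ f y'' (EuclideanSpace.single 1 1)) y' (EuclideanSpace.single j 1)) y -
          fderiv ℝ (fun y' => fderiv ℝ (fun y'' : EuclideanSpace ℝ (Fin 3) =>
            (y'' 1 - c 1) * fderiv ℝ f y'' (EuclideanSpace.single 0 1)) y' (EuclideanSpace.single j 1)) y) y :=
      (hdprod 0 _ j y).hasFDerivAt.sub (hdprod 1 _ j y).hasFDerivAt
    rw [hfun, hD2.fderiv, sub_apply]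
  -- symmetry of second and third derivatives (pointwise)
  have hC2 : ContDiff ℝ 2 f := hf.of_le (by norm_num)
  -- `F a b d := ∂_d ∂_b ∂_a f`; `s1 : F e₁ e₀ e₀ = F e₀ e₀ e₁`, `s2 : F e₀ e₁ e₁ = F e₁ e₁ e₀`
  have hinner : ∀ a b : EuclideanSpace ℝ (Fin 3), (fun y' => fderiv ℝ (fun y'' => fderiv ℝ f y'' a) y' b) =
      fun y' => fderiv ℝ (fun y'' => fderiv ℝ f y'' b) y' a := by
    intro a b; funext y'; exact fderiv_fderiv_symm hC2 y' _ _
  have s1 : fderiv ℝ (fun y' => fderiv ℝ (fun y'' => fderiv ℝ f y'' (EuclideanSpace.single 1 1)) y'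
        (EuclideanSpace.single 0 1)) y (EuclideanSpace.single 0 1) =
      fderiv ℝ (fun y' => fderiv ℝ (fun y'' => fderiv ℝ f y'' (EuclideanSpace.single 0 1)) y'
        (EuclideanSpace.single 0 1)) y (EuclideanSpace.single 1 1) := by
    rw [hinner (EuclideanSpace.single 1 1) (EuclideanSpace.single 0 1),
      fderiv_fderiv_symm (h1 (EuclideanSpace.single 0 1)) y _ _]
  have s2 : fderiv ℝ (fun y' => fderiv ℝ (fun y'' => fderiv ℝ f y'' (EuclideanSpace.single 0 1)) y'
        (EuclideanSpace.single 1 1)) y (EuclideanSpace.single 1 1) =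
      fderiv ℝ (fun y' => fderiv ℝ (fun y'' => fderiv ℝ f y'' (EuclideanSpace.single 1 1)) y'
        (EuclideanSpace.single 1 1)) y (EuclideanSpace.single 0 1) := by
    rw [hinner (EuclideanSpace.single 0 1) (EuclideanSpace.single 1 1),
      fderiv_fderiv_symm (h1 (EuclideanSpace.single 1 1)) y _ _]
  have s3 : fderiv ℝ (fun y' => fderiv ℝ f y' (EuclideanSpace.single 1 1)) y (EuclideanSpace.single 0 1) =
      fderiv ℝ (fun y' => fderiv ℝ f y' (EuclideanSpace.single 0 1)) y (EuclideanSpace.single 1 1) :=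
    fderiv_fderiv_symm hC2 y _ _
  -- `∂_i (Δ_h f)` split
  have hΔsplit : ∀ i : Fin 3,
      fderiv ℝ (fun y' => fderiv ℝ (fun y'' => fderiv ℝ f y'' (EuclideanSpace.single 0 1)) y' (EuclideanSpace.single 0 1) +
            fderiv ℝ (fun y'' => fderiv ℝ f y'' (EuclideanSpace.single 1 1)) y' (EuclideanSpace.single 1 1)) y
          (EuclideanSpace.single i 1) =
        fderiv ℝ (fun y' => fderiv ℝ (fun y'' => fderiv ℝ f y'' (EuclideanSpace.single 0 1)) y' (EuclideanSpace.single 0 1)) y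
            (EuclideanSpace.single i 1) +
          fderiv ℝ (fun y' => fderiv ℝ (fun y'' => fderiv ℝ f y'' (EuclideanSpace.single 1 1)) y' (EuclideanSpace.single 1 1)) y
            (EuclideanSpace.single i 1) := by
    intro i
    rw [fderiv_fun_add (hd2 _ _ y) (hd2 _ _ y), add_apply]
  rw [hsplit 0, hsplit 1, hA0, hA1, hB0, hB1, hΔsplit 0, hΔsplit 1]
  linear_combination 2 * s3 + (y 0 - c 0) * s1 - (y 1 - c 1) * s2

/-- **A rotation germ passes to the horizontal Laplacian.**  If `f ∈ C³(ℝ³)` and `Df(y)[J(y − c)] = 0` for all `y` in an open set `U`,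
then `D(Δ_h f)(y)[J(y − c)] = 0` for all `y ∈ U` (`Δ_h f = ∂₀(∂₀f) + ∂₁(∂₁f)`). -/
theorem rotGerm_laplacianH {f : EuclideanSpace ℝ (Fin 3) → ℝ} (hf : ContDiff ℝ 3 f) (c : EuclideanSpace ℝ (Fin 3))
    {U : Set (EuclideanSpace ℝ (Fin 3))} (hU : IsOpen U) (h : ∀ y ∈ U, fderiv ℝ f y (rotGen (y - c)) = 0)
    {y : EuclideanSpace ℝ (Fin 3)} (hy : y ∈ U) :
    fderiv ℝ (fun y' => fderiv ℝ (fun y'' => fderiv ℝ f y'' (EuclideanSpace.single 0 1)) y' (EuclideanSpace.single 0 1) +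
        fderiv ℝ (fun y'' => fderiv ℝ f y'' (EuclideanSpace.single 1 1)) y' (EuclideanSpace.single 1 1)) y (rotGen (y - c)) = 0 := by
  -- the germ function `g = L_c f` vanishes on `U`, hence so do `∂_j g` (on `U`) and `∂_j² g` (at `y`)
  set g : EuclideanSpace ℝ (Fin 3) → ℝ := fun y'' => fderiv ℝ f y'' (rotGen (y'' - c)) with hg
  have hg0 : ∀ y' ∈ U, fderiv ℝ g y' = 0 := by
    intro y' hy'
    have hev : g =ᶠ[𝓝 y'] fun _ => (0 : ℝ) := Filter.eventually_of_mem (hU.mem_nhds hy') fun z hz => h z hz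
    rw [hev.fderiv_eq, fderiv_fun_const]; rfl
  have hg1 : ∀ j : Fin 3, fderiv ℝ (fun y' => fderiv ℝ g y' (EuclideanSpace.single j 1)) y (EuclideanSpace.single j 1) = 0 := by
    intro j
    have hev : (fun y' => fderiv ℝ g y' (EuclideanSpace.single j 1)) =ᶠ[𝓝 y] fun _ => (0 : ℝ) :=
      Filter.eventually_of_mem (hU.mem_nhds hy) fun z hz => by simp only [hg0 z hz, zero_apply]
    rw [hev.fderiv_eq, fderiv_fun_const]; rfl
  have hΔg : fderiv ℝ (fun y' => fderiv ℝ g y' (EuclideanSpace.single 0 1)) y (EuclideanSpace.single 0 1) +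
      fderiv ℝ (fun y' => fderiv ℝ g y' (EuclideanSpace.single 1 1)) y (EuclideanSpace.single 1 1) = 0 := by
    rw [hg1 0, hg1 1, add_zero]
  rw [hg, laplacianH_rotDeriv hf c y] at hΔg
  rw [fderiv_rotGen_sub_eq]
  linarith

end Summit.NavierStokesRegularity.NavierStokesRegularity.Theorems.PoloidalWindowDoorLrcModEntireAxisKinematics2

end
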